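import Literature.MathematicalPhysics.QuantumFieldTheory.Balaban1983to89.T3CruxEstimates

/-!
# `Balaban1983to89.T3ConstrainedMinimiser` — rung R3, crux K1: the CONSTRAINED MINIMAL WILSON ACTION of the `K`-th approximation over
# the fibres of the descent `D_{n,K}` (Bałaban's background field [Balaban1985UV3] p.266 «U_k — the minimum of the action with the
# constraint», the variational problems of CMP 102:277), as an OBJECT of the tree, and K1's estimate SPLIT into MINIMISER STABILITY
# (two cut-offs, one constraint datum: a classical variational statement) and a FLUCTUATION COMPARISON (everything else)

Cell `ym3-torus` (HUMAN RULING D-0037, YM ladder rung R3), seat `ym3-torus-p2` gen 3.  WHAT THIS IS NOT: not d = 4, not a mass gap, not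
Clay; neither `MinimiserStabilityAt` nor `FluctuationComparisonAt` is proved — they are the two halves of the d = 3 expectations step
(cell DAG nodes N6b «K1-E-min» and N6a/N6c «restricted envelopes + kernel convergence»; abelian templates: [King1986] App. (A.5) — the
minimiser is linear — and Props 3.8/3.9).  What is constructed: the fibres and the constrained minimum (an `sInf`, always defined,
`≥ 0`, `≤` the action of any configuration in the fibre); existence/regularity of minimisers is NOT claimed.

* `fibre F ℰ n K h V` = `{U : D_{n,K} U = V}`; `minAction F ℰ n K h V = inf {A(U) : U ∈ fibre}` (`A` = `wilsonAction4`, unit weight;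
  the Gibbs weight of run `K` is `e^{−β_K A}`, `β_K = (γε_K)⁻¹`); `minAction_nonneg`, `minAction_le`.
* `MinimiserStabilityAt F γ b₀ p₀ m` (schema): summable `r_K` and constants `κ_K` with
  `|β_{K+1}·minAction_{K+1}(V) − β_K·minAction_K(V) − κ_K| ≤ r_K` for every small datum `V` (`PlaqSmall θ(⌊K/m⌋)`) on the comparison
  lattice — the two cut-offs' β-weighted minimal actions with the SAME constraint agree modulo a constant (d = 3: `β_K A^{ε_K} ≈ γ⁻¹∫|F|²`,
  a discretisation statement).
* `FluctuationComparisonAt F γ b₀ p₀ m` (schema): a.e. on the small region both restricted densities are positive and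
  `|(log ρ^{(K+1)} + β_{K+1}minAction_{K+1}) − (log ρ^{(K)} + β_K minAction_K) − κ'_K| ≤ r'_K`, `Σ r' < ∞` — the fluctuation parts
  (effective action minus background action: [Balaban1985UV3] (41)'s `Σ_j 𝒫_j + R`) agree modulo constants.
* **`heightSandwichAt_of_minimiser_fluctuation`**: both ⇒ `T3CruxEstimates.HeightSandwichAt F γ b₀ p₀ m` (hence `UnitTiltAt`,
  `unitTiltAt_of_minimiser_fluctuation`).
-/

noncomputable section

open MeasureTheory Filter Topology
open Literature.MathematicalPhysics.QuantumFieldTheory.Balaban1983to89.T3ContinuumYM3Torus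
open Literature.MathematicalPhysics.QuantumFieldTheory.Balaban1983to89.T3UnitLawDensityEML (ℰp measurableE_ℰp)
open Literature.MathematicalPhysics.QuantumFieldTheory.Balaban1983to89.T3UnitScaleTilt
open Literature.MathematicalPhysics.QuantumFieldTheory.Balaban1983to89.T3RestrictedUnitDensity
open Literature.MathematicalPhysics.QuantumFieldTheory.Balaban1983to89.T3TiltDescent
open Literature.MathematicalPhysics.QuantumFieldTheory.Balaban1983to89.T3CruxEstimates
open Literature.MathematicalPhysics.QuantumFieldTheory.Balaban1983to89.Missing

namespace Literature.MathematicalPhysics.QuantumFieldTheory.Balaban1983to89.T3ConstrainedMinimiser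

/-! ## §1 Fibres of the descent and the constrained minimal action -/

section Fibre

variable (F : T3Family) {G : Type*} [GaugeGroup G] (ℰ : LoopAverage G) (n K : ℕ) (h : n ≤ K)

/-- The FIBRE of the descent `D_{n,K}` over a configuration `V` of the `n`-th approximation's finest lattice: all fine configurations of
the `K`-th approximation whose `(K−n)`-fold block average, read on the `n`-th tower, is `V` (the constraint set of Bałaban's `k`-th
variational problem, `k = K − n`). [cite: Balaban1985UV3, (41) p.266] -/
def fibre (V : GaugeField (F.P n) 0 G) : Set (GaugeField (F.P K) 0 G) := {U | descendTo F ℰ n K h U = V}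

/-- **THE CONSTRAINED MINIMAL WILSON ACTION** `minAction V = inf {A(U) : D_{n,K}U = V}` (unit-weight Wilson action `wilsonAction4` of
the `K`-th approximation's finest lattice; `sInf ∅ = 0` if the fibre is empty).  Bałaban's background field `U_k(V)` realises the
infimum ([Balaban1985UV3] p.266; the variational problems of CMP 102:277); existence is not claimed here. [cite: Balaban1985UV3, (41) p.266] -/
def minAction (V : GaugeField (F.P n) 0 G) : ℝ := sInf ((fun U => wilsonAction4 U) '' fibre F ℰ n K h V)

variable {n K h}

/-- The action values over a fibre are bounded below by `0`. [cite: Balaban1985UV3, (41) p.266] -/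
theorem bddBelow_image_fibre (V : GaugeField (F.P n) 0 G) : BddBelow ((fun U => wilsonAction4 U) '' fibre F ℰ n K h V) :=
  ⟨0, by rintro _ ⟨U, _, rfl⟩; exact wilsonAction4_nonneg U⟩

/-- `0 ≤ minAction V`. [cite: Balaban1985UV3, (41) p.266] -/
theorem minAction_nonneg (V : GaugeField (F.P n) 0 G) : 0 ≤ minAction F ℰ n K h V := by
  unfold minAction
  by_cases hne : ((fun U => wilsonAction4 U) '' fibre F ℰ n K h V).Nonempty
  · exact le_csInf hne (by rintro _ ⟨U, _, rfl⟩; exact wilsonAction4_nonneg U)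
  · rw [Set.not_nonempty_iff_eq_empty.mp hne, Real.sInf_empty]

/-- `minAction V ≤ A(U)` for every `U` in the fibre of `V`. [cite: Balaban1985UV3, (41) p.266] -/
theorem minAction_le {V : GaugeField (F.P n) 0 G} {U : GaugeField (F.P K) 0 G} (hU : descendTo F ℰ n K h U = V) :
    minAction F ℰ n K h V ≤ wilsonAction4 U :=
  csInf_le (bddBelow_image_fibre F ℰ V) ⟨U, hU, rfl⟩

/-- Every fine configuration lies in the fibre of its own descent, so `minAction (D_{n,K}U) ≤ A(U)`. [cite: Balaban1985UV3, (41) p.266] -/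
theorem minAction_descendTo_le (U : GaugeField (F.P K) 0 G) : minAction F ℰ n K h (descendTo F ℰ n K h U) ≤ wilsonAction4 U :=
  minAction_le F ℰ rfl

end Fibre

/-! ## §2 The two schemas and the split of K1's estimate -/

section Split

/-- **MINIMISER STABILITY UNDER CUT-OFF REFINEMENT** (hypothesis schema, never asserted; node N6b «K1-E-min»): for every `K`, with
`n = ⌊K/m⌋`, the β-weighted constrained minimal actions of run `K+1` and run `K` over the fibres of ONE small datum `V` on the comparison
lattice agree modulo a `V`-independent constant: `|β_{K+1}·minAction_{n,K+1}(V) − β_K·minAction_{n,K}(V) − κ_K| ≤ r_K`, `Σ r_K < ∞`.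
(d = 3: `β_K A^{ε_K}(U) ≈ γ⁻¹∫|F_U|²` on smooth fields, so this is a discretisation statement for the constrained Yang–Mills minimiser;
abelian template [King1986] App. (A.5), where the minimiser is linear in `V`.) [cite: King1986, App. (A.5) p.676] -/
def MinimiserStabilityAt (F : T3Family) (γ b₀ p₀ : ℝ) (m : ℕ) : Prop :=
  ∃ (r κ : ℕ → ℝ), Summable r ∧ (∀ K, 0 ≤ r K) ∧
    ∀ K (V : GaugeField (F.P (K / m)) 0 (Matrix.specialUnitaryGroup (Fin 2) ℂ)), PlaqSmall (θBal F.L γ b₀ p₀ (K / m)) V →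
      |(F.scheme ℰp γ).β (K + 1) * minAction F ℰp (K / m) (K + 1) ((Nat.div_le_self K m).trans (Nat.le_succ K)) V -
          (F.scheme ℰp γ).β K * minAction F ℰp (K / m) K (Nat.div_le_self K m) V - κ K| ≤ r K

/-- **FLUCTUATION COMPARISON** (hypothesis schema, never asserted; nodes N6a/N6c): for every `K`, a.e. on the small-field region of the
comparison lattice both restricted densities are positive and their FLUCTUATION PARTS — log-density plus β-weighted constrained minimal
action, i.e. [Balaban1985UV3] (41)'s `Σ_j 𝒫_j + R` up to constants — agree modulo a constant: `|(log ρ^{(K+1),Gd'}_{K+1−n} +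
β_{K+1}minAction_{n,K+1}) − (log ρ^{(K),Gd}_{K−n} + β_K minAction_{n,K}) − κ'_K| ≤ r'_K`, `Σ r'_K < ∞` (abelian template [King1986]
Props 3.8/3.9). [cite: King1986, Prop. 3.8-3.9 pp.664-665] -/
def FluctuationComparisonAt (F : T3Family) (γ b₀ p₀ : ℝ) (m : ℕ) : Prop :=
  ∃ (r κ : ℕ → ℝ), Summable r ∧ (∀ K, 0 ≤ r K) ∧
    ∀ K, ∀ᵐ V ∂fieldMeasure (F.P (K / m)) 0 (Matrix.specialUnitaryGroup (Fin 2) ℂ),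
      PlaqSmall (θBal F.L γ b₀ p₀ (K / m)) V →
        0 < heightDensity F γ (Nat.div_le_self K m) (histGood F ℰp (θBal F.L γ b₀ p₀) K (K / m)) V ∧
        0 < heightDensity F γ ((Nat.div_le_self K m).trans (Nat.le_succ K)) (histGood F ℰp (θBal F.L γ b₀ p₀) (K + 1) (K / m)) V ∧
        |(Real.log (heightDensity F γ ((Nat.div_le_self K m).trans (Nat.le_succ K))
              (histGood F ℰp (θBal F.L γ b₀ p₀) (K + 1) (K / m)) V) +
            (F.scheme ℰp γ).β (K + 1) * minAction F ℰp (K / m) (K + 1) ((Nat.div_le_self K m).trans (Nat.le_succ K)) V) -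
          (Real.log (heightDensity F γ (Nat.div_le_self K m) (histGood F ℰp (θBal F.L γ b₀ p₀) K (K / m)) V) +
            (F.scheme ℰp γ).β K * minAction F ℰp (K / m) K (Nat.div_le_self K m) V) - κ K| ≤ r K

/-- Pointwise: positive `H₀, H₁` with `|log H₁ − log H₀ − κ| ≤ r` satisfy `e^{−r}e^{κ}H₀ ≤ H₁ ≤ e^{r}e^{κ}H₀` (local helper). [folklore] -/
private theorem sandwich_of_log {H₀ H₁ κ r : ℝ} (h₀ : 0 < H₀) (h₁ : 0 < H₁) (h : |Real.log H₁ - Real.log H₀ - κ| ≤ r) :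
    Real.exp (-r) * Real.exp κ * H₀ ≤ H₁ ∧ H₁ ≤ Real.exp r * Real.exp κ * H₀ := by
  obtain ⟨hl, hu⟩ := abs_le.mp h
  have e : H₁ = Real.exp (Real.log H₁ - Real.log H₀) * H₀ := by
    rw [Real.exp_sub, Real.exp_log h₁, Real.exp_log h₀, div_mul_cancel₀ _ h₀.ne']
  constructor
  · rw [e, ← Real.exp_add]
    exact mul_le_mul_of_nonneg_right (Real.exp_le_exp.mpr (by linarith)) h₀.le
  · rw [e, ← Real.exp_add]
    exact mul_le_mul_of_nonneg_right (Real.exp_le_exp.mpr (by linarith)) h₀.le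

/-- **K1's ESTIMATE ⇐ MINIMISER STABILITY ∧ FLUCTUATION COMPARISON** (`γ ≥ 0`): the two schemas give `HeightSandwichAt F γ b₀ p₀ m`
with radii `r_K + r'_K` and constants `e^{κ'_K − κ_K}` (on the small-field region: subtract the minimiser comparison from the fluctuation
comparison and exponentiate; off it both restricted densities vanish a.e., `heightDensity_histGood_ae_eq_zero`). [cite: King1986, Thm 3.4 (3.9) p.656] -/
theorem heightSandwichAt_of_minimiser_fluctuation (F : T3Family) {γ : ℝ} (hγ : 0 ≤ γ) (b₀ p₀ : ℝ) (m : ℕ)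
    (hmin : MinimiserStabilityAt F γ b₀ p₀ m) (hfl : FluctuationComparisonAt F γ b₀ p₀ m) : HeightSandwichAt F γ b₀ p₀ m := by
  obtain ⟨r, κ, hr, hr0, hm⟩ := hmin
  obtain ⟨r', κ', hr', hr0', hf⟩ := hfl
  refine ⟨fun K => r K + r' K, fun K => Real.exp (κ' K - κ K), hr.add hr', fun K => add_nonneg (hr0 K) (hr0' K),
    fun K => Real.exp_pos _, fun K => ?_⟩
  have hz₀ := heightDensity_histGood_ae_eq_zero F hγ (Nat.div_le_self K m) (θBal F.L γ b₀ p₀)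
  have hz₁ := heightDensity_histGood_ae_eq_zero F hγ ((Nat.div_le_self K m).trans (Nat.le_succ K)) (θBal F.L γ b₀ p₀)
  filter_upwards [hf K, hz₀, hz₁] with V hV hVz₀ hVz₁
  by_cases hs : PlaqSmall (θBal F.L γ b₀ p₀ (K / m)) V
  · obtain ⟨hp₀, hp₁, hfl⟩ := hV hs
    have hmn := hm K V hs
    -- log H₁ − log H₀ − (κ' − κ) = [fluctuation difference − κ'] − [minimiser difference − κ]
    have hlog : |Real.log (heightDensity F γ ((Nat.div_le_self K m).trans (Nat.le_succ K))
          (histGood F ℰp (θBal F.L γ b₀ p₀) (K + 1) (K / m)) V) -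
        Real.log (heightDensity F γ (Nat.div_le_self K m) (histGood F ℰp (θBal F.L γ b₀ p₀) K (K / m)) V) -
        (κ' K - κ K)| ≤ r K + r' K := by
      obtain ⟨a1, a2⟩ := abs_le.mp hfl
      obtain ⟨b1, b2⟩ := abs_le.mp hmn
      exact abs_le.mpr ⟨by linarith, by linarith⟩
    exact sandwich_of_log hp₀ hp₁ hlog
  · rw [hVz₀ hs, hVz₁ hs, mul_zero, mul_zero]
    exact ⟨le_rfl, le_rfl⟩

/-- **Hence the route's K1 body**: minimiser stability ∧ fluctuation comparison ⇒ `UnitTiltAt F γ b₀ p₀ m` (`γ ≥ 0`). [cite: King1986, Thm 3.4 (3.9)-(3.13) p.656] -/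
theorem unitTiltAt_of_minimiser_fluctuation (F : T3Family) {γ : ℝ} (hγ : 0 ≤ γ) (b₀ p₀ : ℝ) (m : ℕ)
    (hmin : MinimiserStabilityAt F γ b₀ p₀ m) (hfl : FluctuationComparisonAt F γ b₀ p₀ m) : UnitTiltAt F γ b₀ p₀ m :=
  unitTiltAt_of_heightSandwichAt F hγ (heightSandwichAt_of_minimiser_fluctuation F hγ b₀ p₀ m hmin hfl)

end Split

end Literature.MathematicalPhysics.QuantumFieldTheory.Balaban1983to89.T3ConstrainedMinimiser

end
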